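import Summits.Parity.GeneralizedHardyLittlewood.Theorems.PrimeLevelFamEdgeMomentsBeyondDiagonalDiagRemBothSidedPow
import HarnessLib

/-!
# Route `PrimeLevelFamEdge`, crux K_A `MomentsBeyondDiagonal` (stmt-Parity-20007), line «petersson_layers» v4, stub `stub_diag`:
# **the MIXED both-sided monomial `a_nP₂ ⊗ a_nD₄ · R` (`D₄ = 3P₂² − 2P₄`) for an abstract remainder kernel `R`, saving exponent `A`,
# envelope exponent `N`** (brick of (R₃₃))

The order-`(3,3)` remainder weight has, against `r₀₀`, the both-sided monomial `P₂(k₁)·D₄(k₂)` (coefficient `−15/64`, and its mirror;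
`…DiagRemThreeThreeMonomials`). Unlike `P₂ ⊗ P₂` (`…DiagRemBothSidedPow`), only the ROW is δ-subtracted: `b = a_n·P₂ = c·δ₁ + b̃`
(tails of `b̃` by (P2TAIL)_A), the column `d = a_n·D₄` has bounded partial sums (`…DiagRemTwoTwoColumns.abs_sum_copTauW_decorFour_le`,
`≤ 5(1+log Y)⁶`), so `b ⊗ d = b̃ ⊗ d` (two-sequence estimate) `+ c·(δ₁ ⊗ d)`, and the second piece is the ONE-variable sum
`c·logⁱY·Σ_{k₂≤Y} d(k₂)ℓ⁺(k₂)ʲR(αk₂)` bounded POINTWISE: for `K₁ ≥ 1` the hypothesis `2αK₁Y ≤ 1` gives `αk₂ ≤ 1` and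
`|R(αk₂)| ≤ C₀√(αk₂) ≤ C₀√(2αK₁Y)` (the power-saving term), for `K₁ = 0` trivially `|R(αk₂)| ≤ C₀x^N`. So NO asymptotic for the
partial sums of `a_n·D₄` (no «D4TAIL») is needed.

* `abs_bothsided_primeSq_decorFour_le_pow` — **`|Σ (a_nP₂)(k₁)(a_nD₄)(k₂)ℓ⁺ⁱℓ⁺ʲR(αk₁k₂)| ≤ log^{i+j}Y · C₀ ·
  ((15·W + 5·C_P D)(1+log Y)⁶·√(2αK₁Y) + 95(1+log Y)⁶·C_P D·x^N/(1+log K₁)^A)`**, `W = (1+log Y)⁴ + C_P D`.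

Def-free; theorems only. Helper `--supports stmt-Parity-20007`; closes nothing; K_A, K_B and the Parity summit are NOT proved;
nothing about Landau–Siegel zeros.

## References
* E. Kowalski, P. Michel, J. VanderKam, J. reine angew. Math. 526 (2000), Prop. 5.1 p. 18.
  [cite: KowalskiMichelVanderKam2000, Prop. 5.1 — derivation (both-sided decorated remainder monomials, any order)]
-/

noncomputable section

open Real Finset

namespace Summit.Parity.GeneralizedHardyLittlewood.Theorems.MomentsBeyondDiagonal.DiagCorner

open Literature.Barriers.Parity (Icc_one_eq_Ioc_zero)
open Summit.Parity.GeneralizedHardyLittlewood.Theorems.BeyondDiagonalBeatsQuarter.KernelFormXSq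
  (copTauW copTauW_apply divWeight divWeight_nonneg abs_W_le)
open Summit.Parity.GeneralizedHardyLittlewood.Theorems.BeyondDiagonalBeatsQuarter.Corner

set_option maxHeartbeats 1600000 in
/-- **The mixed both-sided monomial `a_nP₂ ⊗ a_nD₄ · R`** (module docstring).
[cite: KowalskiMichelVanderKam2000, Prop. 5.1 — derivation (both-sided decorated remainder monomial)] -/
theorem abs_bothsided_primeSq_decorFour_le_pow (A : ℕ) {N M : ℕ} (hMN : M ≤ N) {R : ℝ → ℝ} {C₀ : ℝ} (hC₀ : 0 ≤ C₀)
    (hR2 : ∀ (a₁ a₂ : ℕ → ℝ) (Y α B η : ℝ) (K₁ i j : ℕ), 1 ≤ Y → 0 < α → 1 ≤ i → 1 ≤ j →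
      (∀ e : ℕ, e ≤ ⌊Y⌋₊ → |∑ k ∈ Icc 1 e, a₂ k| ≤ B) → (∀ e : ℕ, K₁ ≤ e → |∑ k ∈ Icc 1 e, a₁ k| ≤ η) →
      2 * α * K₁ * Y ≤ 1 →
    |∑ k₁ ∈ Icc 1 ⌊Y⌋₊, ∑ k₂ ∈ Icc 1 ⌊Y⌋₊,
        a₁ k₁ * a₂ k₂ * ellp Y k₁ ^ i * ellp Y k₂ ^ j * R (α * k₁ * k₂)| ≤
      (∑ k ∈ Icc 1 ⌊Y⌋₊, |a₁ k| * ellp Y k ^ i) * (B * (Real.log Y ^ j * (3 * C₀ * Real.sqrt (2 * α * K₁ * Y)))) +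
        (∑ k ∈ Icc 1 ⌊Y⌋₊, |a₂ k| * ellp Y k ^ j) *
          ((2 * η) * (Real.log Y ^ i * (9 * C₀ * (1 + |Real.log (2 * α * Y ^ 2)|) ^ N))))
    (hRs : ∀ y : ℝ, 0 < y → y ≤ 1 → |R y| ≤ C₀ * Real.sqrt y)
    (hRt : ∀ y : ℝ, 1 ≤ y → |R y| ≤ C₀ * (1 + Real.log y) ^ M) :
    ∃ C_P : ℝ, 0 ≤ C_P ∧
    (∀ n : ℕ, n ≠ 0 → ∀ (Y α : ℝ) (K₁ i j : ℕ), 1 ≤ Y → 0 < α → 1 ≤ i → 1 ≤ j → 2 * α * K₁ * Y ≤ 1 →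
    |∑ k₁ ∈ Icc 1 ⌊Y⌋₊, ∑ k₂ ∈ Icc 1 ⌊Y⌋₊,
        (copTauW n k₁ * ∑ p ∈ k₁.primeFactors, Real.log p ^ 2) *
          (copTauW n k₂ * (3 * (∑ p ∈ k₂.primeFactors, Real.log p ^ 2) ^ 2 - 2 * ∑ p ∈ k₂.primeFactors, Real.log p ^ 4)) *
          ellp Y k₁ ^ i * ellp Y k₂ ^ j * R (α * k₁ * k₂)| ≤
      Real.log Y ^ (i + j) * (C₀ *
        ((15 * ((1 + Real.log Y) ^ 4 + C_P * divWeight n) + 5 * (C_P * divWeight n)) * (1 + Real.log Y) ^ 6 *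
            Real.sqrt (2 * α * K₁ * Y) +
          95 * (1 + Real.log Y) ^ 6 * (C_P * divWeight n) *
            (1 + |Real.log (2 * α * Y ^ 2)|) ^ N / (1 + Real.log K₁) ^ A))) := by
  obtain ⟨C_P, hC_P, hP⟩ := abs_sum_copTauW_primeSq_sub_le_pow A
  refine ⟨C_P, hC_P, fun n hn Y α K₁ i j hY hα hi hj hY₁ ↦ ?_⟩
  obtain ⟨c, hc, hcy⟩ := hP n hn
  set D : ℝ := divWeight n with hDdef
  have hD0 : 0 ≤ D := divWeight_nonneg n
  have hY0 : 0 < Y := by linarith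
  have hLY : 0 ≤ Real.log Y := Real.log_nonneg hY
  set L4 : ℝ := (1 + Real.log Y) ^ 4 with hL4
  have hL41 : 1 ≤ L4 := one_le_pow₀ (by linarith)
  set W : ℝ := L4 + C_P * D with hW
  have hW0 : 0 ≤ W := by positivity
  set x : ℝ := 1 + |Real.log (2 * α * Y ^ 2)| with hx
  have hx1 : 1 ≤ x := by rw [hx]; linarith [abs_nonneg (Real.log (2 * α * Y ^ 2))]
  set T : ℝ := C_P * D / (1 + Real.log K₁) ^ A with hT
  have hK0 : 0 ≤ Real.log (K₁ : ℝ) := Real.log_natCast_nonneg K₁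
  have hT0 : 0 ≤ T := by positivity
  have hTle : T ≤ C_P * D := div_le_self (by positivity) (one_le_pow₀ (by linarith))
  set sq : ℝ := Real.sqrt (2 * α * K₁ * Y) with hsq
  have hsq0 : 0 ≤ sq := Real.sqrt_nonneg _
  -- the sequence `b = a_n·P₂` and its data
  set b : ℕ → ℝ := fun k ↦ copTauW n k * ∑ p ∈ k.primeFactors, Real.log p ^ 2 with hb
  have hbt : ∀ e : ℕ, K₁ ≤ e → |∑ k ∈ Icc 1 e, (b k - if k = 1 then c else 0)| ≤ T := by
    intro e he
    rcases Nat.eq_zero_or_pos e with rfl | he0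
    · simp only [show Icc (1 : ℕ) 0 = ∅ from Finset.Icc_eq_empty (by norm_num), Finset.sum_empty, abs_zero]
      exact hT0
    · have h1e : 1 ∈ Icc 1 e := Finset.mem_Icc.2 ⟨le_rfl, he0⟩
      have hsum : ∑ k ∈ Icc 1 e, (b k - if k = 1 then c else 0) = (∑ k ∈ Icc 1 e, b k) - c := by
        rw [Finset.sum_sub_distrib, Finset.sum_ite_eq' (Icc 1 e) 1 (fun _ ↦ c), if_pos h1e]
      rw [hsum]
      have h := hcy (e : ℝ) (by exact_mod_cast he0)
      rw [Nat.floor_natCast] at h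
      refine h.trans ?_
      rw [hT]
      apply div_le_div_of_nonneg_left (by positivity) (by positivity)
      have hle : Real.log (K₁ : ℝ) ≤ Real.log (e : ℝ) := by
        rcases Nat.eq_zero_or_pos K₁ with rfl | hK
        · simp only [Nat.cast_zero, Real.log_zero]; exact Real.log_natCast_nonneg e
        · exact Real.log_le_log (by exact_mod_cast hK) (by exact_mod_cast he)
      exact pow_le_pow_left₀ (by positivity) (by linarith) A
  -- the column `d = a_n·D₄`
  set d : ℕ → ℝ := fun k ↦ copTauW n k *
    (3 * (∑ p ∈ k.primeFactors, Real.log p ^ 2) ^ 2 - 2 * ∑ p ∈ k.primeFactors, Real.log p ^ 4) with hd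
  set L6 : ℝ := (1 + Real.log Y) ^ 6 with hL6
  have hL60 : 0 ≤ L6 := by positivity
  have hdcol : ∀ e : ℕ, e ≤ ⌊Y⌋₊ → |∑ k ∈ Icc 1 e, d k| ≤ 5 * L6 := fun e he ↦ abs_sum_copTauW_decorFour_le n hY he
  have hSd : ∀ m : ℕ, ∑ k ∈ Icc 1 ⌊Y⌋₊, |d k| * ellp Y k ^ m ≤ Real.log Y ^ m * (5 * L6) := by
    intro m; have := sum_abs_copTauW_decorFour_ellp_pow_le n m hY; rw [hL6]; linarith
  -- the absolute sums of `b̃`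
  have hSb : ∀ m : ℕ, ∑ k ∈ Icc 1 ⌊Y⌋₊, |b k| * ellp Y k ^ m ≤ Real.log Y ^ m * L4 :=
    fun m ↦ sum_abs_copTauW_primeSq_ellp_pow_le n m hY
  have h1I : 1 ∈ Icc 1 ⌊Y⌋₊ := Finset.mem_Icc.2 ⟨le_rfl, Nat.le_floor (by simpa using hY)⟩
  have hl1 : ellp Y 1 = Real.log Y := by rw [ellp_eq_log hY0.le h1I]; simp
  have hSbt : ∀ m : ℕ, ∑ k ∈ Icc 1 ⌊Y⌋₊, |b k - if k = 1 then c else 0| * ellp Y k ^ m ≤ Real.log Y ^ m * W := by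
    intro m
    have hpt : ∀ k ∈ Icc 1 ⌊Y⌋₊, |b k - if k = 1 then c else 0| * ellp Y k ^ m ≤
        |b k| * ellp Y k ^ m + (if k = 1 then |c| * ellp Y k ^ m else 0) := by
      intro k _
      split_ifs with hk
      · have : |b k - c| ≤ |b k| + |c| := abs_sub _ _
        have h0 : 0 ≤ ellp Y k ^ m := pow_nonneg (ellp_nonneg Y k) m
        nlinarith
      · rw [sub_zero]; linarith
    refine (Finset.sum_le_sum hpt).trans ?_
    rw [Finset.sum_add_distrib, Finset.sum_ite_eq' (Icc 1 ⌊Y⌋₊) 1, if_pos h1I, hl1]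
    have := hSb m
    rw [hW]; nlinarith [pow_nonneg hLY m]
  -- the split `b = b̃ + c·δ₁`
  set I := Icc 1 ⌊Y⌋₊ with hI
  set bt : ℕ → ℝ := fun k ↦ b k - if k = 1 then c else 0 with hbtdef
  have hbb : ∀ k, b k = bt k + (if k = 1 then c else 0) := by intro k; simp only [hbtdef]; ring
  have hsplit : ∑ k₁ ∈ I, ∑ k₂ ∈ I, b k₁ * d k₂ * ellp Y k₁ ^ i * ellp Y k₂ ^ j * R (α * k₁ * k₂) =
      (∑ k₁ ∈ I, ∑ k₂ ∈ I, bt k₁ * d k₂ * ellp Y k₁ ^ i * ellp Y k₂ ^ j * R (α * k₁ * k₂)) +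
      c * ∑ k₂ ∈ I, d k₂ * ellp Y 1 ^ i * ellp Y k₂ ^ j * R (α * 1 * k₂) := by
    have h2 : ∑ k₁ ∈ I, ∑ k₂ ∈ I, (if k₁ = 1 then c else 0) * d k₂ * ellp Y k₁ ^ i * ellp Y k₂ ^ j * R (α * k₁ * k₂) =
        c * ∑ k₂ ∈ I, d k₂ * ellp Y 1 ^ i * ellp Y k₂ ^ j * R (α * 1 * k₂) := by
      rw [Finset.sum_eq_single_of_mem 1 h1I (fun k₁ _ hk₁ ↦ by
        simp only [if_neg hk₁, zero_mul, Finset.sum_const_zero])]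
      simp only [if_true, Nat.cast_one, Finset.mul_sum]
      refine Finset.sum_congr rfl fun k₂ _ ↦ by ring
    rw [← h2, ← Finset.sum_add_distrib]
    refine Finset.sum_congr rfl fun k₁ _ ↦ ?_
    rw [← Finset.sum_add_distrib]
    refine Finset.sum_congr rfl fun k₂ _ ↦ ?_
    rw [hbb k₁]; ring
  -- piece 1: the two-sequence estimate with row `b̃` and column `d`
  have hA := hR2 bt d Y α (5 * L6) T K₁ i j hY hα hi hj hdcol hbt hY₁
  rw [← hI] at hA
  -- piece 2: pointwise bound on `R(αk₂)`
  have hRpt : ∀ k₂ ∈ I, |R (α * 1 * k₂)| ≤ C₀ * (sq + x ^ N / (1 + Real.log K₁) ^ A) := by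
    intro k₂ hk₂
    have hk1 := (Finset.mem_Icc.1 hk₂).1
    have hk0 : (0 : ℝ) < k₂ := by exact_mod_cast hk1
    have hkY : (k₂ : ℝ) ≤ Y := le_trans (by exact_mod_cast (Finset.mem_Icc.1 hk₂).2) (Nat.floor_le hY0.le)
    rw [show α * 1 * (k₂ : ℝ) = α * k₂ by ring]
    have hy0 : 0 < α * k₂ := mul_pos hα hk0
    have hyY : α * k₂ ≤ α * Y := mul_le_mul_of_nonneg_left hkY hα.le
    rcases Nat.eq_zero_or_pos K₁ with hK | hK
    · -- threshold `0`: trivial bound `C₀·x^N`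
      have hK' : (K₁ : ℝ) = 0 := by exact_mod_cast hK
      have hden : (1 + Real.log (K₁ : ℝ)) ^ A = 1 := by rw [hK', Real.log_zero, add_zero, one_pow]
      rw [hden, div_one]
      have hxN1 : 1 ≤ x ^ N := one_le_pow₀ hx1
      have hxMN : x ^ M ≤ x ^ N := pow_le_pow_right₀ hx1 hMN
      rcases le_or_gt (α * k₂) 1 with hy1 | hy1
      · have h := hRs (α * k₂) hy0 hy1
        calc _ ≤ C₀ * Real.sqrt (α * k₂) := h
          _ ≤ C₀ * 1 := mul_le_mul_of_nonneg_left (Real.sqrt_le_one.2 hy1) hC₀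
          _ ≤ C₀ * (sq + x ^ N) := by apply mul_le_mul_of_nonneg_left _ hC₀; linarith
      · have h := hRt (α * k₂) hy1.le
        have hlx : 1 + Real.log (α * k₂) ≤ x := by
          rw [hx]
          have hlog : Real.log (2 * α * Y ^ 2) = Real.log 2 + Real.log α + 2 * Real.log Y := by
            rw [Real.log_mul (by positivity) (by positivity), Real.log_mul (by norm_num) hα.ne', Real.log_pow]
            push_cast; ring
          have hl2 : 0 < Real.log 2 := Real.log_pos (by norm_num)
          have hlk : Real.log (α * k₂) ≤ Real.log α + Real.log Y := by
            rw [Real.log_mul hα.ne' hk0.ne']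
            linarith [Real.log_le_log hk0 hkY]
          have : Real.log α + Real.log Y ≤ |Real.log (2 * α * Y ^ 2)| := by
            rw [hlog]; exact le_trans (by linarith) (le_abs_self _)
          linarith
        have hla1 : 0 ≤ 1 + Real.log (α * k₂) := by linarith [Real.log_nonneg hy1.le]
        have hpowM : (1 + Real.log (α * k₂)) ^ M ≤ x ^ M := pow_le_pow_left₀ hla1 hlx M
        calc _ ≤ C₀ * (1 + Real.log (α * k₂)) ^ M := h
          _ ≤ C₀ * x ^ N := mul_le_mul_of_nonneg_left (hpowM.trans hxMN) hC₀
          _ ≤ C₀ * (sq + x ^ N) := by apply mul_le_mul_of_nonneg_left _ hC₀; linarith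
    · -- threshold `K₁ ≥ 1`: `αk₂ ≤ αY ≤ 2αK₁Y ≤ 1`, power saving
      have hK1 : (1 : ℝ) ≤ K₁ := by exact_mod_cast hK
      have hαle : α * Y ≤ 2 * α * K₁ * Y := by
        have : α * Y * 1 ≤ α * Y * (2 * K₁) := mul_le_mul_of_nonneg_left (by linarith) (by positivity)
        linarith
      have hy1 : α * k₂ ≤ 1 := (hyY.trans hαle).trans hY₁
      have h := hRs (α * k₂) hy0 hy1
      calc _ ≤ C₀ * Real.sqrt (α * k₂) := h
        _ ≤ C₀ * sq := mul_le_mul_of_nonneg_left (Real.sqrt_le_sqrt (hyY.trans hαle)) hC₀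
        _ ≤ C₀ * (sq + x ^ N / (1 + Real.log K₁) ^ A) := by
            apply mul_le_mul_of_nonneg_left _ hC₀
            have : 0 ≤ x ^ N / (1 + Real.log K₁) ^ A := by positivity
            linarith
  have hP2 : |c * ∑ k₂ ∈ I, d k₂ * ellp Y 1 ^ i * ellp Y k₂ ^ j * R (α * 1 * k₂)| ≤
      |c| * (Real.log Y ^ i * (Real.log Y ^ j * (5 * L6)) * (C₀ * (sq + x ^ N / (1 + Real.log K₁) ^ A))) := by
    rw [abs_mul]
    refine mul_le_mul_of_nonneg_left ?_ (abs_nonneg c)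
    have hterm : ∀ k₂ ∈ I, |d k₂ * ellp Y 1 ^ i * ellp Y k₂ ^ j * R (α * 1 * k₂)| ≤
        Real.log Y ^ i * (|d k₂| * ellp Y k₂ ^ j) * (C₀ * (sq + x ^ N / (1 + Real.log K₁) ^ A)) := by
      intro k₂ hk₂
      rw [abs_mul, abs_mul, abs_mul, hl1, abs_of_nonneg (pow_nonneg hLY i), abs_of_nonneg (pow_nonneg (ellp_nonneg Y k₂) j)]
      have h0 : 0 ≤ |d k₂| * Real.log Y ^ i * ellp Y k₂ ^ j :=
        mul_nonneg (mul_nonneg (abs_nonneg _) (pow_nonneg hLY i)) (pow_nonneg (ellp_nonneg Y k₂) j)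
      calc |d k₂| * Real.log Y ^ i * ellp Y k₂ ^ j * |R (α * 1 * k₂)|
          ≤ |d k₂| * Real.log Y ^ i * ellp Y k₂ ^ j * (C₀ * (sq + x ^ N / (1 + Real.log K₁) ^ A)) :=
            mul_le_mul_of_nonneg_left (hRpt k₂ hk₂) h0
        _ = _ := by ring
    calc _ ≤ ∑ k₂ ∈ I, Real.log Y ^ i * (|d k₂| * ellp Y k₂ ^ j) * (C₀ * (sq + x ^ N / (1 + Real.log K₁) ^ A)) :=
          (Finset.abs_sum_le_sum_abs _ _).trans (Finset.sum_le_sum hterm)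
      _ = Real.log Y ^ i * (∑ k₂ ∈ I, |d k₂| * ellp Y k₂ ^ j) * (C₀ * (sq + x ^ N / (1 + Real.log K₁) ^ A)) := by
          rw [Finset.mul_sum, Finset.sum_mul]
      _ ≤ Real.log Y ^ i * (Real.log Y ^ j * (5 * L6)) * (C₀ * (sq + x ^ N / (1 + Real.log K₁) ^ A)) := by
          have hpos : 0 ≤ C₀ * (sq + x ^ N / (1 + Real.log K₁) ^ A) := by positivity
          exact mul_le_mul_of_nonneg_right (mul_le_mul_of_nonneg_left (hSd j) (pow_nonneg hLY i)) hpos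
  -- bookkeeping
  have hLi : 0 ≤ Real.log Y ^ i := pow_nonneg hLY i
  have hLj : 0 ≤ Real.log Y ^ j := pow_nonneg hLY j
  set CD : ℝ := C_P * D with hCD
  have hCD0 : 0 ≤ CD := by positivity
  have hc' : |c| ≤ CD := hc
  have hxN : 0 ≤ x ^ N := by positivity
  have hK12 : 0 < (1 + Real.log (K₁ : ℝ)) ^ A := by positivity
  have hTdef : T = CD / (1 + Real.log K₁) ^ A := by rw [hT, hCD]
  have t1 : (∑ k ∈ I, |bt k| * ellp Y k ^ i) * (5 * L6 * (Real.log Y ^ j * (3 * C₀ * sq))) ≤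
      Real.log Y ^ (i + j) * (C₀ * (15 * W * L6 * sq)) := by
    have hX : 0 ≤ 5 * L6 * (Real.log Y ^ j * (3 * C₀ * sq)) := by positivity
    calc _ ≤ (Real.log Y ^ i * W) * (5 * L6 * (Real.log Y ^ j * (3 * C₀ * sq))) :=
          mul_le_mul_of_nonneg_right (hSbt i) hX
      _ = _ := by rw [pow_add]; ring
  have t2 : (∑ k ∈ I, |d k| * ellp Y k ^ j) * ((2 * T) * (Real.log Y ^ i * (9 * C₀ * x ^ N))) ≤
      Real.log Y ^ (i + j) * (C₀ * (90 * L6 * CD * x ^ N / (1 + Real.log K₁) ^ A)) := by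
    have hX : 0 ≤ (2 * T) * (Real.log Y ^ i * (9 * C₀ * x ^ N)) := by positivity
    calc _ ≤ (Real.log Y ^ j * (5 * L6)) * ((2 * T) * (Real.log Y ^ i * (9 * C₀ * x ^ N))) :=
          mul_le_mul_of_nonneg_right (hSd j) hX
      _ = _ := by rw [pow_add, hTdef]; field_simp; ring
  have t3 : |c| * (Real.log Y ^ i * (Real.log Y ^ j * (5 * L6)) * (C₀ * (sq + x ^ N / (1 + Real.log K₁) ^ A))) ≤
      Real.log Y ^ (i + j) * (C₀ * (5 * CD * L6 * sq + 5 * L6 * CD * x ^ N / (1 + Real.log K₁) ^ A)) := by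
    have hX : 0 ≤ Real.log Y ^ i * (Real.log Y ^ j * (5 * L6)) * (C₀ * (sq + x ^ N / (1 + Real.log K₁) ^ A)) := by
      positivity
    calc _ ≤ CD * (Real.log Y ^ i * (Real.log Y ^ j * (5 * L6)) * (C₀ * (sq + x ^ N / (1 + Real.log K₁) ^ A))) :=
          mul_le_mul_of_nonneg_right hc' hX
      _ = _ := by rw [pow_add]; ring
  rw [hsplit]
  calc _ ≤ |∑ k₁ ∈ I, ∑ k₂ ∈ I, bt k₁ * d k₂ * ellp Y k₁ ^ i * ellp Y k₂ ^ j * R (α * k₁ * k₂)| +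
        |c * ∑ k₂ ∈ I, d k₂ * ellp Y 1 ^ i * ellp Y k₂ ^ j * R (α * 1 * k₂)| := abs_add_le _ _
    _ ≤ (Real.log Y ^ (i + j) * (C₀ * (15 * W * L6 * sq)) +
          Real.log Y ^ (i + j) * (C₀ * (90 * L6 * CD * x ^ N / (1 + Real.log K₁) ^ A))) +
        Real.log Y ^ (i + j) * (C₀ * (5 * CD * L6 * sq + 5 * L6 * CD * x ^ N / (1 + Real.log K₁) ^ A)) :=
        add_le_add (hA.trans (add_le_add t1 t2)) (hP2.trans t3)
    _ = _ := by ring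

end Summit.Parity.GeneralizedHardyLittlewood.Theorems.MomentsBeyondDiagonal.DiagCorner

end
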